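import Mathlib
import HarnessLib
import Literature.Analysis.FluidPDE.TsaiLocalEnergy
import Summits.NavierStokesRegularity.NavierStokesRegularity.Theorems.LrcModEntire.Negative.TwistedColumn

/-!
# Item `LrcModEntire` (stmt-NavierStokesRegularity-20428) — negative side: the TWISTED (TH) COLUMN, IV: the window,
# the pins, the slope clause, the twist and the apex

Negative-side support (refuter seat ns-regularity-refuter1; D-0081 §C), continuing `…Negative.TwistedColumn`: on the
space–time window `twistWindow = {t < 0} × {0 < x₀ < π, 0 < x₁ < π, 0 < x₂ < 3/20}` the twisted column profile carries
the three non-degeneracy pins (`twistProfile_pins`), its twist bracket is non-zero (`twistProfile_twist_ne_zero`), and its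
shear slope `m(x₂)` — strictly increasing in the height on `(0, π/2)` (`twistSlope_lt_of_lt`) — is a function of time alone
on NO non-empty open subset (`twistProfile_slope_not_time_only`, the item's pin); the apex `(0, 0)` is backward-singular
(`isBackwardSingularPoint_twistProfile`, `V(0) = (0, 0, 1/3)`).
WHAT THIS IS NOT: not a claim about Navier–Stokes regularity — elementary estimates for a kinematic witness. [folklore]
-/

noncomputable section

-- the summit and its single sub-problem share the name (CONVENTIONS §1), as in every Theorems file
set_option linter.dupNamespace false

namespace Summit.NavierStokesRegularity.NavierStokesRegularity.Theorems.LrcModEntire.Negative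

open MeasureTheory Set Function Filter Topology Metric
open scoped RealInnerProductSpace InnerProductSpace
open Literature.Analysis Literature.Analysis.FluidPDE
open Summit.NavierStokesRegularity.NavierStokesRegularity.Theorems.PoloidalWindowRigidity.Negative

local notation "E3" => EuclideanSpace ℝ (Fin 3)
local notation "π" i => (EuclideanSpace.proj (𝕜 := ℝ) (i : Fin 3) : EuclideanSpace ℝ (Fin 3) →L[ℝ] ℝ)
local notation "𝐞" i => (EuclideanSpace.single (i : Fin 3) (1 : ℝ) : EuclideanSpace ℝ (Fin 3))

/-! ## The slope is strictly increasing in the height -/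

/-- **The slope is strictly increasing in the height on `[0, π/2]`** (`m = g(W)` with `g(w) = −1 + 6/w − 6/w² − w⁴`
strictly decreasing on `w ≥ 2` and `W = 2 + cos` strictly decreasing on `[0, π/2]`). [folklore] -/
theorem twistSlope_lt_of_lt {a b : ℝ} (ha : 0 ≤ a) (hab : a < b) (hb : b ≤ Real.pi / 2) :
    twistSlope a < twistSlope b := by
  have hpi := Real.pi_pos
  have hcos : Real.cos b < Real.cos a :=
    Real.strictAntiOn_cos ⟨ha, by linarith⟩ ⟨by linarith, by linarith⟩ hab
  have hWlt : twistW b < twistW a := by unfold twistW; linarith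
  have hcb : 0 ≤ Real.cos b := Real.cos_nonneg_of_mem_Icc ⟨by linarith, hb⟩
  have hB2 : 2 ≤ twistW b := by unfold twistW; linarith
  have hA : 0 < twistW a := twistW_pos a
  have hB : 0 < twistW b := twistW_pos b
  rw [twistSlope_eq, twistSlope_eq]
  set A := twistW a with hAdef
  set B := twistW b with hBdef
  have hA0 : A ≠ 0 := hA.ne'
  have hB0 : B ≠ 0 := hB.ne'
  rw [← sub_pos]
  have key : -1 + 6 / B - 6 / B ^ 2 - B ^ 4 - (-1 + 6 / A - 6 / A ^ 2 - A ^ 4) =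
      (A - B) * (6 * (A * B - A - B) / (A ^ 2 * B ^ 2) + (A + B) * (A ^ 2 + B ^ 2)) := by
    field_simp
    ring
  rw [key]
  refine mul_pos (sub_pos.2 hWlt) ?_
  have h1 : 0 ≤ 6 * (A * B - A - B) / (A ^ 2 * B ^ 2) :=
    div_nonneg (by nlinarith) (mul_nonneg (sq_nonneg A) (sq_nonneg B))
  have h2 : 0 < (A + B) * (A ^ 2 + B ^ 2) :=
    mul_pos (add_pos hA hB) (add_pos_of_pos_of_nonneg (pow_pos hA 2) (sq_nonneg B))
  linarith

/-! ## The window -/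

/-- The window is open. [folklore] -/
theorem isOpen_twistWindow : IsOpen twistWindow := by
  refine isOpen_Iio.prod ?_
  have h0 : Continuous fun x : E3 => x 0 := by fun_prop
  have h1 : Continuous fun x : E3 => x 1 := by fun_prop
  have h2 : Continuous fun x : E3 => x 2 := by fun_prop
  exact (isOpen_lt continuous_const h0).inter ((isOpen_lt h0 continuous_const).inter
    ((isOpen_lt continuous_const h1).inter ((isOpen_lt h1 continuous_const).inter
      ((isOpen_lt continuous_const h2).inter (isOpen_lt h2 continuous_const)))))

/-- The window is non-empty: it contains `(−1, (π/2, π/2, 1/10))`. [folklore] -/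
theorem twistWindow_nonempty : twistWindow.Nonempty := by
  have hpi := Real.pi_gt_three
  refine ⟨((-1 : ℝ), (Real.pi / 2) • (𝐞 0) + (Real.pi / 2) • (𝐞 1) + (1 / 10 : ℝ) • (𝐞 2)), ?_, ?_⟩
  · show (-1 : ℝ) < 0
    norm_num
  · have a0 : ((Real.pi / 2) • (𝐞 0) + (Real.pi / 2) • (𝐞 1) + (1 / 10 : ℝ) • (𝐞 2) : E3) 0 = Real.pi / 2 := by simp
    have a1 : ((Real.pi / 2) • (𝐞 0) + (Real.pi / 2) • (𝐞 1) + (1 / 10 : ℝ) • (𝐞 2) : E3) 1 = Real.pi / 2 := by simp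
    have a2 : ((Real.pi / 2) • (𝐞 0) + (Real.pi / 2) • (𝐞 1) + (1 / 10 : ℝ) • (𝐞 2) : E3) 2 = 1 / 10 := by simp
    show 0 < ((Real.pi / 2) • (𝐞 0) + (Real.pi / 2) • (𝐞 1) + (1 / 10 : ℝ) • (𝐞 2) : E3) 0 ∧
      ((Real.pi / 2) • (𝐞 0) + (Real.pi / 2) • (𝐞 1) + (1 / 10 : ℝ) • (𝐞 2) : E3) 0 < Real.pi ∧
      0 < ((Real.pi / 2) • (𝐞 0) + (Real.pi / 2) • (𝐞 1) + (1 / 10 : ℝ) • (𝐞 2) : E3) 1 ∧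
      ((Real.pi / 2) • (𝐞 0) + (Real.pi / 2) • (𝐞 1) + (1 / 10 : ℝ) • (𝐞 2) : E3) 1 < Real.pi ∧
      0 < ((Real.pi / 2) • (𝐞 0) + (Real.pi / 2) • (𝐞 1) + (1 / 10 : ℝ) • (𝐞 2) : E3) 2 ∧
      ((Real.pi / 2) • (𝐞 0) + (Real.pi / 2) • (𝐞 1) + (1 / 10 : ℝ) • (𝐞 2) : E3) 2 < 3 / 20
    rw [a0, a1, a2]
    refine ⟨by linarith, by linarith, by linarith, by linarith, by norm_num, by norm_num⟩

/-- The window lies in the open backward slab. [folklore] -/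
theorem twistWindow_subset : twistWindow ⊆ Set.Iio (0 : ℝ) ×ˢ Set.univ :=
  Set.prod_mono le_rfl (Set.subset_univ _)

/-- Membership in the window, unfolded. [folklore] -/
theorem mem_twistWindow {z : ℝ × E3} (hz : z ∈ twistWindow) :
    z.1 < 0 ∧ 0 < z.2 0 ∧ z.2 0 < Real.pi ∧ 0 < z.2 1 ∧ z.2 1 < Real.pi ∧ 0 < z.2 2 ∧ z.2 2 < 3 / 20 := by
  simpa [twistWindow, Set.mem_prod] using hz

/-! ## The pins, the slope clause and the twist on the window -/

/-- **The three non-degeneracy pins hold on the window**: `curl v ≠ 0`, `∂₀ v₂ ≠ 0`, `∂₂ v₀ ≠ 0`. [folklore] -/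
theorem twistProfile_pins (z : ℝ × E3) (hz : z ∈ twistWindow) :
    curl (twistProfile z.1) z.2 ≠ 0 ∧
      (fderiv ℝ (twistProfile z.1) z.2 (𝐞 0) 2 ≠ 0 ∨ fderiv ℝ (twistProfile z.1) z.2 (𝐞 1) 2 ≠ 0) ∧
      (fderiv ℝ (twistProfile z.1) z.2 (𝐞 2) 0 ≠ 0 ∨ fderiv ℝ (twistProfile z.1) z.2 (𝐞 2) 1 ≠ 0) := by
  obtain ⟨ht, hx0, hx0', -, -, hx2, hx2'⟩ := mem_twistWindow hz
  have hc := cellAmp_pos ht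
  have hs0 : 0 < Real.sin (z.2 0) := Real.sin_pos_of_pos_of_lt_pi hx0 hx0'
  have hP := twistP_pos hx2 hx2'
  have hm := twistSlope_neg (z.2 2)
  have hPs := mul_pos hP hs0
  refine ⟨fun h0 => ?_, Or.inl ?_, Or.inl ?_⟩
  · have h1 := curl_twistProfile_apply_one z.1 z.2
    rw [h0, PiLp.zero_apply] at h1
    have h2 : (twistSlope (z.2 2) - 1) * twistP (z.2 2) * Real.sin (z.2 0) < 0 := by nlinarith
    have h3 := mul_neg_of_pos_of_neg hc h2
    linarith
  · rw [fderiv_twistProfile_e0_apply_two]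
    have h2 := mul_pos hc hPs
    intro h
    rw [mul_neg] at h
    linarith
  · rw [fderiv_twistProfile_e2_apply_zero]
    have h2 : 0 < -(twistSlope (z.2 2) * twistP (z.2 2) * Real.sin (z.2 0)) := by nlinarith
    exact (mul_pos hc h2).ne'

/-- **The slope clause holds on the window**: for every candidate time-only slope `m : ℝ → ℝ` and every non-empty open
`W₁ ⊆ twistWindow`, some point of `W₁` has `∂₂ v₀ ≠ m(t) ∂₀ v₂` — the actual slope `twistSlope (x₂)` is strictly
increasing in `x₂` while `m(t)` is constant along the vertical segment through a point. [folklore] -/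
theorem twistProfile_slope_not_time_only (m : ℝ → ℝ) (W₁ : Set (ℝ × E3)) (hW₁ : W₁ ⊆ twistWindow)
    (hW₁o : IsOpen W₁) (hW₁n : W₁.Nonempty) :
    ∃ z ∈ W₁, ∃ b : Fin 3, b ≠ 2 ∧
      fderiv ℝ (twistProfile z.1) z.2 (𝐞 2) b ≠ m z.1 * fderiv ℝ (twistProfile z.1) z.2 (𝐞 b) 2 := by
  by_contra hcon
  push Not at hcon
  obtain ⟨z, hz⟩ := hW₁n
  obtain ⟨ε, hε, hball⟩ := Metric.isOpen_iff.mp hW₁o z hz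
  have key : ∀ w ∈ W₁, twistSlope (w.2 2) = m w.1 := fun w hw => by
    have h := hcon w hw 0 (by decide)
    rw [fderiv_twistProfile_e2_apply_zero, fderiv_twistProfile_e0_apply_two] at h
    obtain ⟨hwt, hw0, hw0', -, -, hw2, hw2'⟩ := mem_twistWindow (hW₁ hw)
    have hK : cellAmp w.1 * (twistP (w.2 2) * Real.sin (w.2 0)) ≠ 0 :=
      (mul_pos (cellAmp_pos hwt) (mul_pos (twistP_pos hw2 hw2') (Real.sin_pos_of_pos_of_lt_pi hw0 hw0'))).ne'
    apply mul_left_cancel₀ hK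
    linear_combination -h
  have hmem : ((z.1, z.2 + (ε / 2) • (𝐞 2)) : ℝ × E3) ∈ W₁ := hball (by
    rw [Metric.mem_ball, Prod.dist_eq]
    have d1 : dist ((z.1, z.2 + (ε / 2) • (𝐞 2)) : ℝ × E3).1 z.1 = 0 := by simp
    have d2 : dist ((z.1, z.2 + (ε / 2) • (𝐞 2)) : ℝ × E3).2 z.2 = ε / 2 := by
      show dist (z.2 + (ε / 2) • (𝐞 2)) z.2 = ε / 2
      rw [dist_eq_norm, add_sub_cancel_left, norm_smul, Real.norm_of_nonneg (half_pos hε).le]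
      simp
    rw [d1, d2, max_eq_right (half_pos hε).le]
    exact half_lt_self hε)
  have h1 := key z hz
  have h2 := key _ hmem
  have e2 : ((z.1, z.2 + (ε / 2) • (𝐞 2)) : ℝ × E3).2 2 = z.2 2 + ε / 2 := by simp
  have e1 : ((z.1, z.2 + (ε / 2) • (𝐞 2)) : ℝ × E3).1 = z.1 := rfl
  rw [e1, e2] at h2
  obtain ⟨-, -, -, -, -, hx2, -⟩ := mem_twistWindow (hW₁ hz)
  have hb := mem_twistWindow (hW₁ hmem)
  rw [e2] at hb
  obtain ⟨-, -, -, -, -, -, hy2'⟩ := hb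
  have hlt : twistSlope (z.2 2) < twistSlope (z.2 2 + ε / 2) :=
    twistSlope_lt_of_lt hx2.le (by linarith) (by linarith [Real.pi_gt_three])
  rw [h1, h2] at hlt
  exact lt_irrefl _ hlt

/-- **The twist bracket is non-zero on the window** (`= −(−t)^{-1} sin x₀ sin x₁ < 0`). [folklore] -/
theorem twistProfile_twist_ne_zero (z : ℝ × E3) (hz : z ∈ twistWindow) :
    fderiv ℝ (fun x => fderiv ℝ (twistProfile z.1) x (𝐞 2) 2) z.2 (𝐞 0) *
          fderiv ℝ (twistProfile z.1) z.2 (𝐞 1) 2 -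
        fderiv ℝ (fun x => fderiv ℝ (twistProfile z.1) x (𝐞 2) 2) z.2 (𝐞 1) *
          fderiv ℝ (twistProfile z.1) z.2 (𝐞 0) 2 ≠ 0 := by
  rw [twistProfile_twist]
  obtain ⟨ht, hx0, hx0', hx1, hx1', -, -⟩ := mem_twistWindow hz
  have h := mul_pos (pow_pos (cellAmp_pos ht) 2)
    (mul_pos (Real.sin_pos_of_pos_of_lt_pi hx0 hx0') (Real.sin_pos_of_pos_of_lt_pi hx1 hx1'))
  intro h0
  linarith

/-! ## The apex is backward-singular -/

/-- The vertical velocity: `v₂(t, x) = (−t)^{-1/2} (P(x₂) cos x₀ + Q(x₂) cos x₁)`. [folklore] -/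
theorem twistProfile_apply_two (t : ℝ) (x : E3) :
    twistProfile t x 2 = cellAmp t * (twistP (x 2) * Real.cos (x 0) + twistQ (x 2) * Real.cos (x 1)) := by
  simp only [twistProfile, PiLp.smul_apply, smul_eq_mul, twistField_apply_two]

/-- **The twisted column profile is backward-singular at the apex**: `v(t, 0) = (0, 0, (−t)^{-1/2}/3)` exceeds every
level for `t → 0⁻`, and continuity gives essential unboundedness on every parabolic cylinder `Q_r(0, 0)`
(`isBackwardSingularPoint_of_forall_exists_continuousAt`). [folklore] -/
theorem isBackwardSingularPoint_twistProfile : IsBackwardSingularPoint twistProfile 0 := by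
  apply isBackwardSingularPoint_of_forall_exists_continuousAt
  intro r hr M
  set K : ℝ := |M| + 1 with hKdef
  have hK : 0 < K := by positivity
  have hMK : M < K := by rw [hKdef]; linarith [le_abs_self M]
  set τ : ℝ := min (r ^ 2 / 2) ((1 / (3 * K)) ^ 2 / 2) with hτdef
  have h3K : 0 < 1 / (3 * K) := by positivity
  have hτpos : 0 < τ := lt_min (by positivity) (by positivity)
  have hτr : τ < r ^ 2 := lt_of_le_of_lt (min_le_left _ _) (by nlinarith)
  have hτK : τ < (1 / (3 * K)) ^ 2 := lt_of_le_of_lt (min_le_right _ _) (by nlinarith)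
  have hsqrt : Real.sqrt τ < 1 / (3 * K) := by
    rw [Real.sqrt_lt' h3K]
    exact hτK
  have hsqrtpos : 0 < Real.sqrt τ := Real.sqrt_pos.2 hτpos
  have hamp : cellAmp (-τ) = (Real.sqrt τ)⁻¹ := by simp [cellAmp]
  refine ⟨((-τ : ℝ), (0 : E3)), ?_, ?_, ?_⟩
  · rw [mem_parabolicCylinder]
    refine ⟨⟨?_, ?_⟩, ?_⟩
    · simp only [Prod.fst_zero]; linarith
    · simp only [Prod.fst_zero]; linarith
    · simp only [Prod.snd_zero, dist_self]; exact hr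
  · exact continuousOn_twistProfile.continuousAt
      ((isOpen_Iio.prod isOpen_univ).mem_nhds ⟨by simp [hτpos], Set.mem_univ _⟩)
  · have hcomp : twistProfile (-τ) 0 2 = (Real.sqrt τ)⁻¹ * (1 / 3) := by
      rw [twistProfile_apply_two, hamp, PiLp.zero_apply, PiLp.zero_apply, PiLp.zero_apply, Real.cos_zero,
        twistP_zero, twistQ_zero]
      ring
    have hlow : (Real.sqrt τ)⁻¹ * (1 / 3) ≤ ‖twistProfile (-τ) 0‖ := by
      calc (Real.sqrt τ)⁻¹ * (1 / 3) = |twistProfile (-τ) 0 2| := by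
            rw [hcomp, abs_of_nonneg]
            positivity
        _ = ‖twistProfile (-τ) 0 2‖ := (Real.norm_eq_abs _).symm
        _ ≤ ‖twistProfile (-τ) 0‖ := PiLp.norm_apply_le _ 2
    have hKlt : K < (Real.sqrt τ)⁻¹ * (1 / 3) := by
      rw [← div_eq_inv_mul, lt_div_iff₀ hsqrtpos]
      calc K * Real.sqrt τ < K * (1 / (3 * K)) := mul_lt_mul_of_pos_left hsqrt hK
        _ = 1 / 3 := by field_simp
    show M < ‖twistProfile (-τ) 0‖
    linarith

end Summit.NavierStokesRegularity.NavierStokesRegularity.Theorems.LrcModEntire.Negative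

end
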